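import Summits.Ventures.QEC.Thresholds.ToricCodeXSectorPhenomenologicalMWPM
import Summits.Ventures.QEC.Thresholds.ToricCodeLatticeThresholdConverses
import Summits.Ventures.QEC.Thresholds.DepolarizingThresholdConverses
import HarnessLib

/-!
# Certified INTERVALS of record for the lattice toric code at the memory-16 / cubic memory-12 kernel certificates:
# `.0357 < p_c ≤ 1/4` (both sectors), `.3712 < y_c ≤ 1/2`, `.0535 < p_c^{depol} ≤ 3/8`, `.0112 < p_c^{ph} ≤ 1/4` (both records)
# — min-weight AND MWPM decoder families — UNCONDITIONAL, kernel

Venture QEC, `Summits/Ventures/QEC/Thresholds/` (LADDER-QEC rung Q5 «certified interval floor ≤ p_c ≤ ceiling»; qec-type-09 gen 5).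
qec-lit-2's interval files (`ToricCodeLatticeThresholdConverses.lean`, `ToricCodeLatticePhenomConverses.lean`,
`DepolarizingThresholdConverses.lean`) pair the ceilings valid for EVERY decoder family (genie / no-cloning bounds: `1/4` code
capacity and phenomenological per sector, `1/2` loss, `3/8` depolarizing) with the floors of their day (`.0293`, `.3373`,
`.0106`). This file restates the intervals with the CURRENT kernel floors (qec-type-03's symmetry-reduced certificates
`μ(ℤ²) ≤ 2.6939`, `μ(ℤ³) ≤ 4.7476`: `ToricCodeThresholdKernelSymmK16.lean`, `ToricCodePhenomenologicalKernelZ3SymmK12.lean`) for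
the minimum-weight class and for the MWPM class (`ToricCodeMWPMThresholdsSymmK16.lean`, `ToricCodeXSectorPhenomenologicalMWPM.lean`):

| quantity | interval | decoder class of the floor |
|---|---|---|
| code capacity, `Z` sector | **`.0357 < p_c ≤ 1/4`** | every min-weight family (`toric_capacity_accuracyThreshold_mem_0357`); every MWPM family (`toric_mwpm_capacity_accuracyThreshold_mem_0357`) |
| code capacity, `X` sector | **`.0357 < p_c^X ≤ 1/4`** | min-weight (`toric_x_capacity_accuracyThreshold_mem_0357`); MWPM (`toric_x_mwpm_capacity_accuracyThreshold_mem_0357`) |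
| loss | **`.3712 < y_c ≤ 1/2`** | decoder-free (`toric_loss_accuracyThreshold_mem_0371`) |
| depolarizing, sector-wise | **`.0535 < p_c^{depol} ≤ 3/8`** | min-weight pairs (`toric_depolarizing_accuracyThreshold_mem_0535`); MWPM pairs (`toric_depolarizing_mwpm_accuracyThreshold_mem_0535`) |
| phenomenological `q = p`, star record | **`.0112 < p_c^{ph} ≤ 1/4`** | min-weight space-time (`toric_phenom_accuracyThreshold_mem_0112`); space-time MWPM (`toric_phenom_mwpm_accuracyThreshold_mem_0112`) |
| phenomenological `q = p`, plaquette record | **`.0112 < p_c^{X,ph} ≤ 1/4`** | space-time MWPM (`toric_x_phenom_mwpm_accuracyThreshold_mem_0112`; min-weight: `toric_x_phenom_accuracyThreshold_mem_0112` in `ToricCodeXSectorPhenomenologicalDual.lean`) |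

The ceilings hold for every decoder family of the respective kind (`T_L ≥ 1` for the phenomenological ones); all statements
UNCONDITIONAL, tier CERTIFIED (kernel), axioms standard, 0 named facts. DKLP's printed `.0373` / `.0114` and the numerical
`p_c ≈ .103`, `≈ .029` are CLAIMS/VALIDATED numbers, not theorems. Theorem-only file.

## References

* [DennisEtAl2002] E. Dennis, A. Kitaev, A. Landahl, J. Preskill, J. Math. Phys. 43 (2002) 4452, arXiv:quant-ph/0110143, §4.6
  (p_c), §5.3 eqs. (p_c_2d), (threshold_iso_num).
* [RichardsonUrbanke2008] T. Richardson, R. Urbanke, *Modern Coding Theory*, Lemma 4.78 (erasure decomposition).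
* [PonitzTittmann2000] A. Pönitz, P. Tittmann, Electron. J. Combin. 7 (2000) R21, Table 2 (`2.6939`, `4.7476`).
-/

noncomputable section

namespace Summit.Ventures.QEC.Thresholds

open Filter Topology Finset Matrix
open Literature.InformationTheory.QuantumCodes
open Literature.InformationTheory.QuantumCodes.ToricCode
open Literature.Probability.RandomPlanarGeometry

/-! ### Code capacity -/

/-- **`.0357 < p_c ≤ 1/4`** (perfect measurement, `Z` sector): floor for every minimum-weight decoder family, ceiling for
every decoder family. [cite: DennisEtAl2002, §5.3 eq. (p_c_2d) and §4.6; RichardsonUrbanke2008, Lemma 4.78] -/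
theorem toric_capacity_accuracyThreshold_mem_0357 {D : (L : ℕ) → ZDecoder (L + 1)}
    (hD : ∀ L, (D L).IsMinWeight (syn (L + 1)) (cycles (L + 1)) hammingNorm) :
    (0.0357 : ℝ) < accuracyThreshold (toricFailureFamily D) ∧ accuracyThreshold (toricFailureFamily D) ≤ 1 / 4 :=
  ⟨accuracyThreshold_gt_0357 hD, toric_capacity_accuracyThreshold_le_quarter D⟩

/-- **`.0357 < p_c^{MWPM} ≤ 1/4`** (perfect measurement, `Z` sector, every MWPM family). [cite: DennisEtAl2002, §4.4 p. 18, §5.3 eq. (p_c_2d), §4.6] -/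
theorem toric_mwpm_capacity_accuracyThreshold_mem_0357 (m : (L : ℕ) → EdgeMetric (starEnds (L + 1)))
    {D : (L : ℕ) → ZDecoder (L + 1)} (hD : ∀ L, IsMatchingDecoder (m L) (D L)) :
    (0.0357 : ℝ) < accuracyThreshold (toricFailureFamily D) ∧ accuracyThreshold (toricFailureFamily D) ≤ 1 / 4 :=
  ⟨toric_mwpm_accuracyThreshold_gt_0357 m hD, toric_capacity_accuracyThreshold_le_quarter D⟩

/-- **`.0357 < p_c^X ≤ 1/4`** (perfect measurement, `X` sector, every minimum-weight decoder family of the plaquette syndrome;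
ceiling by lattice duality `xFailureFamily_toricCode`). [cite: DennisEtAl2002, §4.1, §5.3 eq. (p_c_2d), §4.6] -/
theorem toric_x_capacity_accuracyThreshold_mem_0357 (DX : (L : ℕ) → Decoder (Syndrome (L + 1)) (Chain (L + 1)))
    (hDX : ∀ L, (DX L).IsMinWeight (toricCode (L + 1)).xSyndrome
      ((toricCode (L + 1)).kerZ : Set (Chain (L + 1))) hammingNorm) :
    (0.0357 : ℝ) < accuracyThreshold (xFailureFamily (fun L => toricCode (L + 1)) DX) ∧
      accuracyThreshold (xFailureFamily (fun L => toricCode (L + 1)) DX) ≤ 1 / 4 := by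
  refine ⟨toric_x_accuracyThreshold_gt_0357 DX hDX, ?_⟩
  rw [xFailureFamily_toricCode]
  exact toric_capacity_accuracyThreshold_le_quarter _

/-- **`.0357 < p_c^{X,MWPM} ≤ 1/4`** (every MWPM family of the plaquette syndrome). [cite: DennisEtAl2002, §4.4 p. 18, §5.3 eq. (p_c_2d), §4.6] -/
theorem toric_x_mwpm_capacity_accuracyThreshold_mem_0357 (m : (L : ℕ) → EdgeMetric (plaqEnds (L + 1)))
    (DX : (L : ℕ) → Decoder (Syndrome (L + 1)) (Chain (L + 1))) (hDX : ∀ L, IsMatchingDecoder (m L) (DX L)) :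
    (0.0357 : ℝ) < accuracyThreshold (xFailureFamily (fun L => toricCode (L + 1)) DX) ∧
      accuracyThreshold (xFailureFamily (fun L => toricCode (L + 1)) DX) ≤ 1 / 4 := by
  refine ⟨toric_x_mwpm_accuracyThreshold_gt_0357 m DX hDX, ?_⟩
  rw [xFailureFamily_toricCode]
  exact toric_capacity_accuracyThreshold_le_quarter _

/-! ### Loss -/

/-- **`.3712 < y_c ≤ 1/2`** for the toric code under the loss channel (decoder-free: correctable erasures).
[cite: DennisEtAl2002, §4.6; StaceBarrettDoherty2009, p. 2] -/
theorem toric_loss_accuracyThreshold_mem_0371 :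
    (0.3712 : ℝ) < accuracyThreshold erasureFamily ∧ accuracyThreshold erasureFamily ≤ 1 / 2 :=
  ⟨loss_accuracyThreshold_gt_0371, ToricCode.erasure_threshold_le_half (isThresholdLowerBound_accuracyThreshold _)⟩

/-! ### Depolarizing noise, sector-wise decoding -/

/-- **`.0535 < p_c^{depol} ≤ 3/8`** (i.i.d. depolarizing noise, sector-wise minimum-weight decoding of the toric code; ceiling
for every pair of sector decoder families). [cite: DennisEtAl2002, §4.1 and §4.6] [cite: RichardsonUrbanke2008, Lemma 4.78] -/
theorem toric_depolarizing_accuracyThreshold_mem_0535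
    (DX : (L : ℕ) → Decoder (Syndrome (L + 1)) (Chain (L + 1))) (DZ : (L : ℕ) → ZDecoder (L + 1))
    (hDX : ∀ L, (DX L).IsMinWeight (toricCode (L + 1)).xSyndrome
      ((toricCode (L + 1)).kerZ : Set (Chain (L + 1))) hammingNorm)
    (hDZ : ∀ L, (DZ L).IsMinWeight (syn (L + 1)) (cycles (L + 1)) hammingNorm) :
    (0.0535 : ℝ) < accuracyThreshold (depolarizingFailureFamily (fun L => toricCode (L + 1)) DX DZ) ∧
      accuracyThreshold (depolarizingFailureFamily (fun L => toricCode (L + 1)) DX DZ) ≤ 3 / 8 :=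
  ⟨toric_depolarizing_accuracyThreshold_gt_0535 DX DZ hDX hDZ,
    depolarizingAccuracyThreshold_le_three_eighths (fun L => toricCode (L + 1)) (fun _ => toricCode_k_pos) DX DZ⟩

/-- **`.0535 < p_c^{depol,MWPM} ≤ 3/8`** (sector-wise MWPM decoding of the toric code). [cite: DennisEtAl2002, §4.1, §4.4 p. 18 and §4.6] -/
theorem toric_depolarizing_mwpm_accuracyThreshold_mem_0535 (mX : (L : ℕ) → EdgeMetric (plaqEnds (L + 1)))
    (mZ : (L : ℕ) → EdgeMetric (starEnds (L + 1)))
    (DX : (L : ℕ) → Decoder (Syndrome (L + 1)) (Chain (L + 1))) (DZ : (L : ℕ) → ZDecoder (L + 1))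
    (hDX : ∀ L, IsMatchingDecoder (mX L) (DX L)) (hDZ : ∀ L, IsMatchingDecoder (mZ L) (DZ L)) :
    (0.0535 : ℝ) < accuracyThreshold (depolarizingFailureFamily (fun L => toricCode (L + 1)) DX DZ) ∧
      accuracyThreshold (depolarizingFailureFamily (fun L => toricCode (L + 1)) DX DZ) ≤ 3 / 8 :=
  ⟨toric_depolarizing_mwpm_accuracyThreshold_gt_0535 mX mZ DX DZ hDX hDZ,
    depolarizingAccuracyThreshold_le_three_eighths (fun L => toricCode (L + 1)) (fun _ => toricCode_k_pos) DX DZ⟩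

/-! ### Phenomenological noise (`q = p`) -/

/-- **`.0112 < p_c^{ph} ≤ 1/4`** (noisy star record, every minimum-weight space-time decoder family, poly `T_L ≥ 1`; ceiling for
every space-time decoder family). [cite: DennisEtAl2002, §5.3 eq. (threshold_iso_num) and §4.6; RichardsonUrbanke2008, Lemma 4.78] -/
theorem toric_phenom_accuracyThreshold_mem_0112 {T : ℕ → ℕ} (hT : IsPolyBounded T) (hT1 : ∀ L, 0 < T L)
    {D : (L : ℕ) → STDecoder (L + 1) (T L)}
    (hD : ∀ L, (D L).IsMinWeight (stSyn (L + 1) (T L)) (stCycles (L + 1) (T L)) hammingNorm) :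
    (0.0112 : ℝ) < accuracyThreshold (phenomFailureFamily T D) ∧ accuracyThreshold (phenomFailureFamily T D) ≤ 1 / 4 :=
  ⟨phenom_accuracyThreshold_gt_0112 hT hD,
    ToricCode.phenom_threshold_le_quarter T hT1 D (isThresholdLowerBound_accuracyThreshold _)⟩

/-- **`.0112 < p_c^{ph,MWPM} ≤ 1/4`** (noisy star record, every space-time MWPM family, poly `T_L ≥ 1`).
[cite: DennisEtAl2002, §5.1 p. 19, §5.3 eq. (threshold_iso_num), §4.6] -/
theorem toric_phenom_mwpm_accuracyThreshold_mem_0112 {T : ℕ → ℕ} (hT : IsPolyBounded T) (hT1 : ∀ L, 0 < T L)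
    (m : (L : ℕ) → EdgeMetric (stLinkEnds (L + 1) (T L))) {D : (L : ℕ) → STDecoder (L + 1) (T L)}
    (hD : ∀ L, IsMatchingDecoder (m L) (D L)) :
    (0.0112 : ℝ) < accuracyThreshold (phenomFailureFamily T D) ∧ accuracyThreshold (phenomFailureFamily T D) ≤ 1 / 4 :=
  ⟨phenom_mwpm_accuracyThreshold_gt_0112 hT m hD,
    ToricCode.phenom_threshold_le_quarter T hT1 D (isThresholdLowerBound_accuracyThreshold _)⟩

/-- **`.0112 < p_c^{X,ph,MWPM} ≤ 1/4`** (noisy PLAQUETTE record, every space-time MWPM family, poly `T_L ≥ 1`).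
[cite: DennisEtAl2002, §5.1 p. 19, §5.3 eq. (threshold_iso_num), §4.6] -/
theorem toric_x_phenom_mwpm_accuracyThreshold_mem_0112 {T : ℕ → ℕ} (hT : IsPolyBounded T) (hT1 : ∀ L, 0 < T L)
    (m : ∀ L, EdgeMetric (CSSPhenom.stEnds (plaqEnds (L + 1)) (T L)))
    {DX : ∀ L, CSSPhenom.STDecoder (Vertex (L + 1)) (Edge (L + 1)) (T L)}
    (hDX : ∀ L, IsMatchingDecoder (m L) (DX L)) :
    (0.0112 : ℝ) < accuracyThreshold (xPhenomFailureFamily (fun L => toricCode (L + 1)) T DX) ∧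
      accuracyThreshold (xPhenomFailureFamily (fun L => toricCode (L + 1)) T DX) ≤ 1 / 4 :=
  toric_x_phenom_accuracyThreshold_mem_0112 hT hT1 DX
    fun L => toric_isMinWeight_of_isMatchingDecoder_plaqST (L + 1) (T L) (hDX L)

end Summit.Ventures.QEC.Thresholds

end
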